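import Summits.ValiantsHypothesis.ValiantsHypothesis.Theorems.MonotoneRestorationQP.Negative.OrbitCompressionFalseWithoutVP

/-!
# MonotoneRestoration, aside `OrbitCompressionFalseWithoutVP` (stmt-ValiantsHypothesis-18333) — CLOSED BY NAME

Route `MonotoneRestoration` of `ValiantsHypothesis`, aside item `OrbitCompressionFalseWithoutVP`
(the planner's BANKED CERTIFICATE): the `VP` hypothesis of `OrbitCompressionQP` is load-bearing —
with `IsVPFamily f` deleted the compression statement is FALSE, witnessed by the symmetric power
chain `(Σ_ij x_ij)^(2^(2^n))` (orbit size `≤ 2^((log₂ n + 2)^2)`, while any labelled circuit with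
`≤ 2^((log₂ n + c)^c)` gates computes a polynomial of degree `< 2^(2^n)` for large `n`).

The statement is, symbol for symbol, the tree theorem
`Summit.ValiantsHypothesis.ValiantsHypothesis.Theorems.orbitCompression_false_without_VP`
(`Theorems/MonotoneRestorationQP/Negative/OrbitCompressionFalseWithoutVP.lean`, Dawar–Wilsenach 2025
setting); this file closes the item by name. Honest framing: a VH-free negative certificate about
a hypothesis of a dormant route; VP ≠ VNP is NOT proved and nothing here is progress on it.
-/

noncomputable section

-- the summit and the problem share the name `ValiantsHypothesis` (D-0017 single-conjunct layout)
set_option linter.dupNamespace false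

namespace Summit.ValiantsHypothesis.ValiantsHypothesis.Theorems.MonotoneRestoration

/-- **`OrbitCompressionFalseWithoutVP` (stmt-ValiantsHypothesis-18333):** orbit compression without
the `VP` hypothesis fails — by name, `Theorems.orbitCompression_false_without_VP`. -/
theorem orbitCompressionFalseWithoutVP_proof :
    Summit.ValiantsHypothesis.ValiantsHypothesis.Theses.MonotoneRestoration.OrbitCompressionFalseWithoutVP :=
  Summit.ValiantsHypothesis.ValiantsHypothesis.Theorems.orbitCompression_false_without_VP

end Summit.ValiantsHypothesis.ValiantsHypothesis.Theorems.MonotoneRestoration
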